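import Literature.Probability.Percolation.FiveArmCoreGadget
import HarnessLib

/-!
# The five-arm upper bound for plain arms in the arrangement `B W B W W`: `P ≤ C(m)/n²`

Topic `Literature/Probability/Percolation`; family `crit-perc` (site percolation on `𝕋` at `p = 1/2`).
PROOFS ONLY (no named fact). The assembly of the separation-free proof of the five-arm upper bound
for the plain-arm events of `FiveArmPlainArms.lean` whose landing tuple is arranged as `B W B W W`
around `∂Λ_m` (P. Nolin, EJP 13 (2008), §5.2 Thm. 24, five-arm item, with §4.1 finite energy;
W. Werner, PCMI 2009, First exercise sheet, "Five-arm exponent", 1)–2)):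

`P_{1/2}(plainArms κ_E s m n) = 2^{|core|} P_{1/2}(plainArms ∩ paint)` (finite energy,
`real_plainArms_eq_mul_paint`); the painted event, translated to every site `g` of `Λ_{R₀}`
(translation invariance of `P_{1/2}`), is contained in the kissing certificate at `x⋆ + g` inside
`Λ_R` (`GadgetIdx.mem_kissCert` and `kissCert_of_relabel_shift`); the expected number of certified
points of `x⋆ + Λ_{R₀}` is at most `6` (`KissCount.sum_real_kissCert_le_six`, with the ratio `ρ` of
`exists_ratio_polyArmProb_one_le_half`); hence `#Λ_{R₀} · P(plainArms ∩ paint) ≤ 6` with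
`R₀ ≍ n/ρ`, i.e. `P_{1/2}(plainArms κ_E s m n) ≤ C(m)/n²` uniformly in the arranged tuples
(`exists_real_plainArms_E_le`).

* `kissCert_of_relabel_shift` — transport of the certificate under translations of `𝕋`;
* `succ_sq_le_card_triBall` — `(R+1)² ≤ #Λ_R`;
* `exists_real_plainArms_E_le` — **the bound**.

## References

* P. Nolin, Near-critical percolation in two dimensions, *Electron. J. Probab.* 13 (2008)
  1562–1623, §4.1, §5.2 Thm. 24 (arXiv 0711.4948: Thm. 23 (iii)) [Nolin2008].
* W. Werner, *Lectures on two-dimensional critical percolation*, IAS/Park City Math. Ser. 16 (2009),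
  First exercise sheet, "Five-arm exponent", 1)–2) (arXiv 0710.0856) [WernerPCMI2009].

## Mathlib / tree

Tree: `GadgetIdx.mem_kissCert` (`FiveArmCoreGadget.lean`); `KissCount.sum_real_kissCert_le_six`,
`KissCount.exists_ratio_polyArmProb_one_le_half`, `kissCert` (`FiveArmKissingCount.lean`);
`real_plainArms_eq_mul_paint`, `card_coreOf_le` (`FiveArmPlainArms.lean`);
`sitePercolation_real_preimage_relabel`, `SiteConfig.relabel`, `mem_relabel_triShiftIso_neg_iff`,
`triShiftIso`, `pathIn_map_iso` (`SitePercolationMeasure.lean`, `TriCrossingChains.lean`,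
`TriSubcriticalCrossing.lean`, `TriRSWChaining.lean`); `triNorm_add_le`, `triNorm_neg`.
-/

noncomputable section

open MeasureTheory Set

namespace Literature.Probability.Percolation

open LatticeModels

/-! ### Translating the certificate -/

/-- Norm after a translation. [folklore] -/
theorem triNorm_add_ge_sub (v g : Site 2) : triNorm v - triNorm g ≤ triNorm (v + g) := by
  have h := triNorm_add_le (v + g) (-g)
  rw [add_neg_cancel_right, triNorm_neg] at h
  linarith

/-- **Transport of the kissing certificate under a translation.** If the translated configuration
`ω - g` is certified at `x` inside `Λ_{R'}`, then `ω` is certified at `x + g` inside `Λ_R`, provided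
`|x + g| + 2 ≤ R` and `R + |g| ≤ R'` (the translated paths are cut at their first arrival on
`∂Λ_R`, `∂Λ_{R+1}`). [folklore] -/
theorem kissCert_of_relabel_shift {x g : Site 2} {R R' : ℕ} {ω : SiteConfig (Site 2)}
    (hω : SiteConfig.relabel (triShiftIso (-g)).toEquiv ω ∈ kissCert x R') (hxg : triNorm (x + g) + 2 ≤ R)
    (hR' : (R : ℤ) + triNorm g ≤ R') : ω ∈ kissCert (x + g) R := by
  set ω' := SiteConfig.relabel (triShiftIso (-g)).toEquiv ω with hω'
  have hmem : ∀ z, z ∈ ω' ↔ z + g ∈ ω := fun z => mem_relabel_triShiftIso_neg_iff g ω z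
  obtain ⟨hx, o, δ, k, hδ, hk₀, hk₁, hb, hd, S, hS, hdisj, hesc⟩ := hω
  -- translating paths by `g`
  have tr : ∀ {A : Set (Site 2)} {a b : Site 2}, PathIn triGraph A a b → PathIn triGraph ((fun v => v + g) '' A) (a + g) (b + g) :=
    fun hp => pathIn_map_iso (triShiftIso g) hp
  have gnorm : ∀ v, triNorm v - triNorm g ≤ triNorm (v + g) := fun v => triNorm_add_ge_sub v g
  -- the black paths
  have black : ∀ {a : Site 2}, triGraph.Adj x a → (∃ t, triNorm t = R' ∧ PathIn triGraph {v | v ∈ ω' ∧ triNorm v ≤ R'} a t) →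
      ∃ t, triNorm t = R ∧ PathIn triGraph {v | v ∈ ω ∧ triNorm v ≤ R} (a + g) t := by
    rintro a ha ⟨t, ht, hp⟩
    have hp' := tr hp
    have ha' : triNorm (a + g) < R := by
      have had : triGraph.Adj (x + g) (a + g) := (triGraph_adj_shift_iff g x a).2 ha
      have h1 := triNorm_le_triNorm_add_one_of_adj had
      omega
    obtain ⟨t', ht', hq⟩ := Gadget.exists_pathIn_trunc hp' ha' (by have := gnorm t; omega)
    refine ⟨t', ht', hq.mono ?_⟩
    rintro v ⟨⟨u, ⟨hu, -⟩, rfl⟩, hv⟩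
    exact ⟨(hmem u).1 hu, hv⟩
  -- the escapes
  set S' : Fin 3 → Set (Site 2) := fun l => ((fun v => v + g) '' S l) ∩ {v | triNorm v ≤ R + 1} with hS'
  refine ⟨fun h => hx ((hmem x).2 h), o, δ, k, hδ, hk₀, hk₁, ?_, ?_, S', fun l => ?_, ?_, fun l => ?_⟩
  · rw [add_right_comm]; exact black (triGraph_adj_add_triDir x o) hb
  · rw [add_right_comm]; exact black (triGraph_adj_add_triDir x (o + δ)) hd
  · rintro v ⟨⟨u, hu, rfl⟩, hv⟩
    obtain ⟨h1, h2, -⟩ := hS l hu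
    exact ⟨fun h => h1 ((hmem u).2 h), fun h => h2 (add_right_cancel h), hv⟩
  · intro a b hab
    refine Set.disjoint_left.2 ?_
    rintro v ⟨⟨u, hu, rfl⟩, -⟩ ⟨⟨u', hu', he⟩, -⟩
    have : u' = u := add_right_cancel he
    subst this
    exact Set.disjoint_left.1 (hdisj hab) hu hu'
  · obtain ⟨f, hf, hp⟩ := hesc l
    have hp' := tr hp
    have hstart : triNorm (x + triDir (k l) + g) < R + 1 := by
      have had : triGraph.Adj (x + g) (x + triDir (k l) + g) := (triGraph_adj_shift_iff g x _).2 (triGraph_adj_add_triDir x (k l))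
      have h1 := triNorm_le_triNorm_add_one_of_adj had
      omega
    obtain ⟨f', hf', hq⟩ := Gadget.exists_pathIn_trunc (R := R + 1) hp' (by push_cast; exact hstart)
      (by have := gnorm f; push_cast; omega)
    refine ⟨f', by rw [hf']; push_cast; ring, ?_⟩
    rw [add_right_comm]
    refine hq.mono ?_
    rintro v ⟨hv1, hv2⟩
    exact ⟨hv1, by have : triNorm v ≤ ((R + 1 : ℕ) : ℤ) := hv2; push_cast at this; exact this⟩

/-! ### The size of the hexagonal ball -/

/-- `(R + 1)² ≤ #Λ_R`: the sites `(a, -b)`, `0 ≤ a, b ≤ R`, have norm `≤ R`. [folklore] -/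
theorem succ_sq_le_card_triBall (R : ℕ) : (R + 1) ^ 2 ≤ (triBall R).card := by
  classical
  let f : ℕ × ℕ → Site 2 := fun ab => ![(ab.1 : ℤ), -(ab.2 : ℤ)]
  have hinj : Set.InjOn f ↑(Finset.range (R + 1) ×ˢ Finset.range (R + 1)) := by
    rintro ⟨a, b⟩ - ⟨a', b'⟩ - h
    have h0 := congrFun h 0
    have h1 := congrFun h 1
    simp only [f, Matrix.cons_val_zero, Matrix.cons_val_one, Nat.cast_inj, neg_inj] at h0 h1
    rw [h0, h1]
  have hmaps : ∀ ab ∈ Finset.range (R + 1) ×ˢ Finset.range (R + 1), f ab ∈ triBall R := by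
    rintro ⟨a, b⟩ hab
    rw [Finset.mem_product, Finset.mem_range, Finset.mem_range] at hab
    rw [mem_triBall_iff, triNorm_eq_of_apply_eq (y := f (a, b)) (a := a) (b := -(b : ℤ)) (by simp [f]) (by simp [f])]
    omega
  calc (R + 1) ^ 2 = (Finset.range (R + 1) ×ˢ Finset.range (R + 1)).card := by
        rw [Finset.card_product, Finset.card_range, sq]
    _ ≤ (triBall R).card := Finset.card_le_card_of_injOn f hmaps hinj

/-! ### The bound -/

open Gadget

/-- **The five-arm upper bound for arranged plain arms.** For every core radius `m ≥ 4` there is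
`C` such that for all landing indices `i` with `GadgetIdx m i` and all `n ≥ m`,
`P_{1/2}(plainArms κ_E (rp m ∘ i) m n) ≤ C / n²`. (Werner 2 c: "`(#Λ_{m/2}) u_{2m} ≤ E(K²) < c`";
Nolin Thm. 24, five-arm item, with the finite-energy constant `2^{|Λ_m|}` of §4.1.)
[cite: Nolin2008, §5.2 Thm. 24, five-arm item, with §4.1 (arXiv 0711.4948: Thm. 23 (iii))] -/
theorem exists_real_plainArms_E_le {m : ℕ} (hm : 4 ≤ m) :
    ∃ C : ℝ, ∀ i : Fin 5 → ℕ, GadgetIdx m i → ∀ n : ℕ, m ≤ n →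
      (triSitePercolation half).real (plainArms κE (sOf m i) m n) ≤ C / (n : ℝ) ^ 2 := by
  classical
  obtain ⟨ρ, hρ, hhalf⟩ := KissCount.exists_ratio_polyArmProb_one_le_half
  -- threshold and constant
  set n₀ : ℕ := 2 * (ρ * (m + 2) + 2) * (ρ + 1) with hn₀
  set K : ℝ := 2 ^ (triBall m).card * 6 * (2 * ((ρ : ℝ) + 1)) ^ 2 with hK
  have hK0 : 0 ≤ K := by positivity
  refine ⟨K + (n₀ : ℝ) ^ 2, fun i hi n hmn => ?_⟩
  set μ := triSitePercolation half with hμ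
  have hn : (0 : ℝ) < n := by exact_mod_cast (show 0 < n by omega)
  have hn2 : (0 : ℝ) < (n : ℝ) ^ 2 := by positivity
  by_cases hsmall : n < n₀
  · -- small `n`: the probability is at most `1 ≤ n₀² / n²`
    calc μ.real (plainArms κE (sOf m i) m n) ≤ 1 := measureReal_le_one
      _ ≤ (n₀ : ℝ) ^ 2 / (n : ℝ) ^ 2 := by
          rw [le_div_iff₀ hn2, one_mul]
          exact_mod_cast Nat.pow_le_pow_left hsmall.le 2
      _ ≤ (K + (n₀ : ℝ) ^ 2) / (n : ℝ) ^ 2 := div_le_div_of_nonneg_right (by linarith) hn2.le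
  push Not at hsmall
  -- radii
  obtain ⟨R₀, hR₀⟩ : ∃ R₀, R₀ = (n - 1 - ρ * (m + 2)) / (ρ + 1) := ⟨_, rfl⟩
  have hρ1 : 1 ≤ ρ := by omega
  have hprod : ρ * (m + 2) + 2 ≤ n := by
    have : ρ * (m + 2) + 2 ≤ (ρ * (m + 2) + 2) * (2 * (ρ + 1)) := Nat.le_mul_of_pos_right _ (by omega)
    have e : (ρ * (m + 2) + 2) * (2 * (ρ + 1)) = 2 * (ρ * (m + 2) + 2) * (ρ + 1) := by ring
    omega
  have hdiv : R₀ * (ρ + 1) ≤ n - 1 - ρ * (m + 2) := hR₀ ▸ Nat.div_mul_le_self _ _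
  have hlt : n - 1 - ρ * (m + 2) < R₀ * (ρ + 1) + (ρ + 1) := hR₀ ▸ Nat.lt_div_mul_add (by omega)
  set R₁ : ℕ := R₀ + m + 2 with hR₁
  set R : ℕ := ρ * R₁ with hR
  -- `n ≤ 2 (ρ + 1) (R₀ + 1)`
  have hnR₀ : n ≤ 2 * ((R₀ + 1) * (ρ + 1)) := by
    have hQ : R₀ * (ρ + 1) + (ρ + 1) = (R₀ + 1) * (ρ + 1) := by ring
    have h2 : 2 * (ρ * (m + 2) + 2) ≤ n := le_trans (Nat.le_mul_of_pos_right _ (show 0 < ρ + 1 by omega)) hsmall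
    rw [hQ] at hlt
    generalize ρ * (m + 2) = P at *
    generalize (R₀ + 1) * (ρ + 1) = Q at *
    omega
  -- the translated painted events are certified kissing events
  set E := plainArms κE (sOf m i) m n ∩ paint (coreOf (sOf m i) m) (blackRun m i) with hE
  have hEm : MeasurableSet E := (measurableSet_plainArms _ _ _ _).inter (determinedBy_paint _ _).measurableSet_of_finset
  have hxs : triNorm (xs m i) = (m : ℤ) - 1 := hi.triNorm_rp_m1 _
  have hsub : ∀ g ∈ triBall R₀, SiteConfig.relabel (triShiftIso (-g)).toEquiv ⁻¹' E ⊆ kissCert (xs m i + g) R := by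
    intro g hg ω hω
    rw [mem_triBall_iff] at hg
    have hmn2 : m + 2 ≤ n := le_trans (Nat.le_mul_of_pos_left (m + 2) (by omega : 0 < ρ)) (by omega)
    have hcert := hi.mem_kissCert (R := n - 1) (n := n) (by omega) (by omega) hω.1 hω.2
    refine kissCert_of_relabel_shift hcert ?_ ?_
    · have := triNorm_add_le (xs m i) g
      have : ((m : ℤ) - 1 + R₀) + 2 ≤ R := by
        have : (R : ℤ) = ρ * (R₀ + m + 2) := by rw [hR, hR₁]; push_cast; ring
        nlinarith
      omega
    · have h1 : ((n - 1 : ℕ) : ℤ) = n - 1 := by push_cast [Nat.cast_sub (show 1 ≤ n by omega)]; ring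
      rw [h1]
      have : (R : ℤ) + R₀ ≤ n - 1 := by
        have e : (R : ℤ) + R₀ = R₀ * (ρ + 1) + ρ * (m + 2) := by rw [hR, hR₁]; push_cast; ring
        have : ((R₀ * (ρ + 1) : ℕ) : ℤ) ≤ ((n - 1 - ρ * (m + 2) : ℕ) : ℤ) := by exact_mod_cast hdiv
        push_cast [Nat.cast_sub (show 1 ≤ n by omega), Nat.sub_sub, Nat.cast_sub (show 1 + ρ * (m + 2) ≤ n by omega)] at this
        linarith
      linarith
  -- each translate has the probability of `E`
  have hterm : ∀ g ∈ triBall R₀, μ.real E ≤ μ.real (kissCert (xs m i + g) R) := by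
    intro g hg
    calc μ.real E = μ.real (SiteConfig.relabel (triShiftIso (-g)).toEquiv ⁻¹' E) := by
          rw [hμ]; unfold triSitePercolation; exact (sitePercolation_real_preimage_relabel _ half E).symm
      _ ≤ μ.real (kissCert (xs m i + g) R) := measureReal_mono (hsub g hg)
  -- the expected number of certified translates is at most `6`
  have hsix : ∑ g ∈ triBall R₀, μ.real (kissCert (xs m i + g) R) ≤ 6 := by
    have hinj : Set.InjOn (fun g => xs m i + g) ↑(triBall R₀) := fun a _ b _ h => add_left_cancel h
    rw [← Finset.sum_image (f := fun x => μ.real (kissCert x R)) hinj]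
    refine KissCount.sum_real_kissCert_le_six (R₁ := R₁) (by rw [hR, hR₁]; nlinarith) _ (fun x hx => ?_)
      (hhalf R₁ R (by omega) le_rfl)
    obtain ⟨g, hg, rfl⟩ := Finset.mem_image.1 hx
    rw [mem_triBall_iff] at hg
    have := triNorm_add_le (xs m i) g
    rw [hR₁]; push_cast; omega
  -- hence `#Λ_{R₀} · P(E) ≤ 6`
  have hcardE : ((R₀ : ℝ) + 1) ^ 2 * μ.real E ≤ 6 := by
    calc ((R₀ : ℝ) + 1) ^ 2 * μ.real E ≤ (triBall R₀).card * μ.real E := by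
          refine mul_le_mul_of_nonneg_right ?_ measureReal_nonneg
          exact_mod_cast succ_sq_le_card_triBall R₀
      _ = ∑ g ∈ triBall R₀, μ.real E := by rw [Finset.sum_const, nsmul_eq_mul]
      _ ≤ ∑ g ∈ triBall R₀, μ.real (kissCert (xs m i + g) R) := Finset.sum_le_sum hterm
      _ ≤ 6 := hsix
  -- finite energy
  have hfe : μ.real (plainArms κE (sOf m i) m n) ≤ 2 ^ (triBall m).card * μ.real E := by
    rw [hμ, real_plainArms_eq_mul_paint κE (sOf m i) m n (blackRun m i)]
    refine mul_le_mul_of_nonneg_right ?_ measureReal_nonneg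
    exact pow_le_pow_right₀ (by norm_num) (card_coreOf_le _ _)
  -- conclusion
  have hR₀pos : (0 : ℝ) < ((R₀ : ℝ) + 1) ^ 2 := by positivity
  have hE6 : μ.real E ≤ 6 / ((R₀ : ℝ) + 1) ^ 2 := by rw [le_div_iff₀ hR₀pos, mul_comm]; exact hcardE
  have hnR : (n : ℝ) ^ 2 ≤ (2 * ((ρ : ℝ) + 1)) ^ 2 * ((R₀ : ℝ) + 1) ^ 2 := by
    rw [← mul_pow]
    have : (n : ℝ) ≤ 2 * ((ρ : ℝ) + 1) * ((R₀ : ℝ) + 1) := by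
      calc (n : ℝ) ≤ ((2 * ((R₀ + 1) * (ρ + 1)) : ℕ) : ℝ) := by exact_mod_cast hnR₀
        _ = 2 * ((ρ : ℝ) + 1) * ((R₀ : ℝ) + 1) := by push_cast; ring
    exact pow_le_pow_left₀ hn.le this 2
  calc μ.real (plainArms κE (sOf m i) m n) ≤ 2 ^ (triBall m).card * (6 / ((R₀ : ℝ) + 1) ^ 2) :=
        hfe.trans (mul_le_mul_of_nonneg_left hE6 (by positivity))
    _ = K / ((2 * ((ρ : ℝ) + 1)) ^ 2 * ((R₀ : ℝ) + 1) ^ 2) := by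
        rw [hK]; field_simp
    _ ≤ K / (n : ℝ) ^ 2 := div_le_div_of_nonneg_left hK0 hn2 hnR
    _ ≤ (K + (n₀ : ℝ) ^ 2) / (n : ℝ) ^ 2 := div_le_div_of_nonneg_right (le_add_of_nonneg_right (by positivity)) hn2.le

end Literature.Probability.Percolation

end
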